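import Mathlib.NumberTheory.Real.Irrational
import Mathlib.Analysis.SpecialFunctions.Log.Basic
import Mathlib.LinearAlgebra.Dimension.OrzechProperty
import Literature.NumberTheory.DiophantineApproximation.NesterenkoCriterion
import Literature.NumberTheory.Transcendental.ZetaLinearFormsCriterion
import Literature.NumberTheory.Transcendental.PeriodsWave0
import HarnessLib

/-!
# ζ(5) search — criteria for linear forms in SEVERAL numbers (cell `pub-zeta5`, TYPER)

HONEST FRAMING: systematic search; no irrationality claim unless certified.

Companion of `Criteria.lean` (criterion C1, two-term forms in `1, ξ`). Most explicit constructions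
aimed at `ζ(5)` (Brown's cellular integrals on `M_{0,8}`, the well-poised hypergeometric families
of Ball–Rivoal and Zudilin) produce linear forms in `1, ζ(3), ζ(5)` (or in `1, ζ(5), ζ(7), …`)
rather than in `1, ζ(5)` alone. This file types what such forms prove, in the two available
regimes (cell `CRITERIA.md`, criterion C2):

* `exists_irrational_of_scaled_linear_forms` — the elementary "ONE OF" conclusion: scaled
  integer forms `D n ℓ n / Φ n = a n 0 + ∑_{j} a n j θ j → 0`, non-zero infinitely often, give
  `∃ j, Irrational (θ j)` (tree:
  `Literature.NumberTheory.Transcendental.exists_irrational_of_integerLinearForms`, Zudilin 2004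
  §8 / Fischler Bourbaki 910 §3.3). Useless for `ζ(5)` as soon as `ζ(3)` is among the `θ j`.
* `linearIndependent_of_nesterenko` — **Nesterenko's criterion (1985) in the full-dimension
  case**: integer forms in `θ : ι → ℝ` with coefficients `≤ β'^n` (all `β' > β`) and EXACT rate
  `|ℓ_n|^{1/n} → α`, `0 < α < 1 < β`, and `card ι - 1 < 1 - log α / log β`, make `θ` linearly
  independent over `ℚ` (tree: the PROVED
  `Literature.NumberTheory.DiophantineApproximation.NesterenkoCriterion.nesterenko_criterion`,
  plus `finrank (span (range θ)) ≤ card ι` and Mathlib's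
  `linearIndependent_iff_card_eq_finrank_span`).
* `irrational_of_linearIndependent` — if `θ j₁ = 1` and `θ` is `ℚ`-linearly independent, every
  other `θ j` is irrational.
* `irrational_of_nesterenko_margin` — the same in the EXPONENT form of `CRITERIA.md` C2: forms of
  exact size `e^{-σ n}`, coefficients `≤ e^{Q' n}` for every `Q' > Q > 0`, and the full-independence
  MARGIN `(card ι - 2) Q < σ`.
* `zetaFive_of_threeTermForms` — the instantiation at `θ = (1, ζ(3), ζ(5))`: margin `Q < σ`
  (i.e. `μ₂ = σ - Q > 0`) gives `LinearIndependent ℚ ![1, ζ(3), ζ(5)]` and the tree's open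
  statement `ZetaFiveIrrational`. No such forms are constructed here; this is the implication the
  census computes the margin `μ₂` against.

Everything is PROVED; no named fact, no `sorry`, no closed `Prop` definitions.
-/

noncomputable section

open Filter Topology Finset Module
open Literature.NumberTheory.Transcendental
open Literature.NumberTheory.DiophantineApproximation

namespace Summit.KontsevichZagierPeriods.Zeta5Search

/-! ### "One of" — the elementary criterion for several numbers, with denominators -/

/-- **"One of `θ j` is irrational", with denominators and savings.** Raw forms `ℓ n` with
`D n ℓ n = Φ n (a₀ n + ∑ j, a n j θ j)` for large `n` (`a₀ n, a n j ∈ ℤ`, `D n, Φ n ∈ ℕ⁺`),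
`D n ℓ n / Φ n → 0` and `ℓ n ≠ 0` infinitely often: then some `θ j` is irrational. -/
theorem exists_irrational_of_scaled_linear_forms {ι : Type*} [Fintype ι] (θ : ι → ℝ)
    (ℓ : ℕ → ℝ) (D Φ : ℕ → ℕ) (a₀ : ℕ → ℤ) (a : ℕ → ι → ℤ)
    (hD : ∀ n, 0 < D n) (hΦ : ∀ n, 0 < Φ n)
    (harith : ∀ᶠ n : ℕ in atTop, (D n : ℝ) * ℓ n = Φ n * (a₀ n + ∑ j, (a n j : ℝ) * θ j))
    (hsmall : Tendsto (fun n => (D n : ℝ) * ℓ n / Φ n) atTop (𝓝 0))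
    (hne : ∃ᶠ n : ℕ in atTop, ℓ n ≠ 0) : ∃ j, Irrational (θ j) := by
  have hΦ' : ∀ n, (Φ n : ℝ) ≠ 0 := fun n => by exact_mod_cast (hΦ n).ne'
  have hD' : ∀ n, (D n : ℝ) ≠ 0 := fun n => by exact_mod_cast (hD n).ne'
  have heq : ∀ᶠ n : ℕ in atTop, (D n : ℝ) * ℓ n / Φ n = (a₀ n : ℝ) + ∑ j, (a n j : ℝ) * θ j := by
    filter_upwards [harith] with n hn
    rw [hn, mul_div_cancel_left₀ _ (hΦ' n)]
  refine exists_irrational_of_integerLinearForms θ (fun n => (a₀ n : ℝ) + ∑ j, (a n j : ℝ) * θ j)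
    a₀ a (fun n => rfl) (hsmall.congr' heq) ?_
  refine (hne.and_eventually heq).mono fun n hn => ?_
  rw [← hn.2]
  exact div_ne_zero (mul_ne_zero (hD' n) hn.1) (hΦ' n)

/-! ### Nesterenko's criterion in the full-dimension case -/

/-- **Full linear independence from Nesterenko's criterion.** Let `θ : ι → ℝ`, integer forms
`ℓ_n = ∑ j, p n j · θ j` with `|p n j| ≤ β'^n` for all large `n` for every `β' > β`, and
`|ℓ_n|^{1/n} → α` with `0 < α < 1 < β`. If `card ι - 1 < 1 - log α / log β` then `θ` is linearly
independent over `ℚ` (Nesterenko's bound `dim ≥ 1 - log α / log β` exceeds `card ι - 1`, and the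
dimension of the span is at most `card ι`). -/
theorem linearIndependent_of_nesterenko {ι : Type*} [Fintype ι] (θ : ι → ℝ) (p : ℕ → ι → ℤ)
    {α β : ℝ} (hα : 0 < α) (hα1 : α < 1) (hβ : 1 < β)
    (hp : ∀ β' : ℝ, β < β' → ∀ᶠ n : ℕ in atTop, ∀ j, |(p n j : ℝ)| ≤ β' ^ n)
    (hℓ : Tendsto (fun n : ℕ => |∑ j, (p n j : ℝ) * θ j| ^ (1 / (n : ℝ))) atTop (𝓝 α))
    (hfull : (Fintype.card ι : ℝ) - 1 < 1 - Real.log α / Real.log β) :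
    LinearIndependent ℚ θ := by
  have h1 := NesterenkoCriterion.nesterenko_criterion θ p hα hα1 hβ hp hℓ
  have h2 : (Set.range θ).finrank ℚ ≤ Fintype.card ι := finrank_range_le_card θ
  have h3 : (Fintype.card ι : ℝ) - 1 < ((Set.range θ).finrank ℚ : ℝ) := hfull.trans_le h1
  have h4 : Fintype.card ι < (Set.range θ).finrank ℚ + 1 := by
    have h5 : ((Fintype.card ι : ℕ) : ℝ) < ((Set.range θ).finrank ℚ : ℝ) + 1 := by linarith
    exact_mod_cast h5
  exact linearIndependent_iff_card_eq_finrank_span.2 (by omega)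

/-- **Linear independence with a `1` forces irrationality.** If `θ` is linearly independent over
`ℚ` and `θ j₁ = 1`, then `θ j` is irrational for every `j ≠ j₁` (a rational value `θ j = r` would
be the relation `r · θ j₁ - θ j = 0`). -/
theorem irrational_of_linearIndependent {ι : Type*} (θ : ι → ℝ) (hli : LinearIndependent ℚ θ)
    {j₁ j : ι} (hj : j ≠ j₁) (h1 : θ j₁ = 1) : Irrational (θ j) := by
  classical
  rintro ⟨r, hr⟩
  -- the relation `r • θ j₁ + (-1) • θ j = 0` on the pair `{j₁, j}`
  set g : ι → ℚ := fun i => if i = j then -1 else if i = j₁ then r else 0 with hg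
  have hsum : ∑ i ∈ ({j, j₁} : Finset ι), g i • θ i = 0 := by
    rw [sum_pair hj]
    simp only [hg, if_true, if_neg hj.symm, h1, ← hr]
    simp [Rat.smul_def]
  have h := linearIndependent_iff'.1 hli {j, j₁} g hsum j (by simp)
  simp [hg] at h

/-- **Nesterenko's criterion, exponent/margin form (cell `CRITERIA.md` C2).** Let `θ : ι → ℝ`
with `θ j₁ = 1`, integer forms `ℓ_n = ∑ j, p n j θ j` of EXACT size `|ℓ_n|^{1/n} → e^{-σ}`
(`σ > 0`) with coefficients `|p n j| ≤ e^{Q' n}` for all large `n`, for every `Q' > Q` (`Q > 0`).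
If the full-independence margin holds, `(card ι - 2) · Q < σ`, then `θ` is `ℚ`-linearly
independent and every `θ j`, `j ≠ j₁`, is irrational. -/
theorem irrational_of_nesterenko_margin {ι : Type*} [Fintype ι] (θ : ι → ℝ) (j₁ : ι)
    (h1 : θ j₁ = 1) (p : ℕ → ι → ℤ) {σ Q : ℝ} (hσ : 0 < σ) (hQ : 0 < Q)
    (hp : ∀ Q' : ℝ, Q < Q' → ∀ᶠ n : ℕ in atTop, ∀ j, |(p n j : ℝ)| ≤ Real.exp (Q' * n))
    (hℓ : Tendsto (fun n : ℕ => |∑ j, (p n j : ℝ) * θ j| ^ (1 / (n : ℝ))) atTop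
      (𝓝 (Real.exp (-σ))))
    (hmargin : ((Fintype.card ι : ℝ) - 2) * Q < σ) :
    LinearIndependent ℚ θ ∧ ∀ j, j ≠ j₁ → Irrational (θ j) := by
  have hα : 0 < Real.exp (-σ) := Real.exp_pos _
  have hα1 : Real.exp (-σ) < 1 := Real.exp_lt_one_iff.2 (by linarith)
  have hβ : 1 < Real.exp Q := Real.one_lt_exp_iff.2 hQ
  have hp' : ∀ β' : ℝ, Real.exp Q < β' → ∀ᶠ n : ℕ in atTop, ∀ j, |(p n j : ℝ)| ≤ β' ^ n := by
    intro β' hβ'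
    have hβ'0 : 0 < β' := (Real.exp_pos Q).trans hβ'
    have hQ' : Q < Real.log β' := by
      rw [Real.lt_log_iff_exp_lt hβ'0]; exact hβ'
    filter_upwards [hp (Real.log β') hQ'] with n hn j
    have e : Real.exp (Real.log β' * n) = β' ^ n := by
      rw [mul_comm, Real.exp_nat_mul, Real.exp_log hβ'0]
    rw [← e]; exact hn j
  have hfull : (Fintype.card ι : ℝ) - 1 < 1 - Real.log (Real.exp (-σ)) / Real.log (Real.exp Q) := by
    rw [Real.log_exp, Real.log_exp, neg_div, sub_neg_eq_add]
    have : (Fintype.card ι : ℝ) - 2 < σ / Q := by rw [lt_div_iff₀ hQ]; exact hmargin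
    linarith
  have hli := linearIndependent_of_nesterenko θ p hα hα1 hβ hp' hℓ hfull
  exact ⟨hli, fun j hj => irrational_of_linearIndependent θ hli hj h1⟩

/-! ### The instantiation at `1, ζ(3), ζ(5)` -/

/-- **Three-term forms in `1, ζ(3), ζ(5)` (cell `CRITERIA.md` C2, `N = 3`).** Integer forms
`p n 0 + p n 1 ζ(3) + p n 2 ζ(5)` of exact size `e^{-σ n}` with coefficients `≤ e^{Q' n}`
(all `Q' > Q > 0`) and margin `μ₂ = σ - Q > 0` prove that `1, ζ(3), ζ(5)` are linearly independent
over `ℚ`; in particular the tree's open statement `ZetaFiveIrrational` (`ζ(5) ∉ ℚ`). No such forms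
are known; this is the implication the search measures `μ₂` against. -/
theorem zetaFive_of_threeTermForms (p : ℕ → Fin 3 → ℤ) {σ Q : ℝ} (hσ : 0 < σ) (hQ : 0 < Q)
    (hp : ∀ Q' : ℝ, Q < Q' → ∀ᶠ n : ℕ in atTop, ∀ j, |(p n j : ℝ)| ≤ Real.exp (Q' * n))
    (hℓ : Tendsto (fun n : ℕ =>
      |(p n 0 : ℝ) + p n 1 * zetaValue 3 + p n 2 * zetaValue 5| ^ (1 / (n : ℝ))) atTop
      (𝓝 (Real.exp (-σ))))
    (hmargin : Q < σ) :
    LinearIndependent ℚ ![(1 : ℝ), zetaValue 3, zetaValue 5] ∧ ZetaFiveIrrational := by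
  set θ : Fin 3 → ℝ := ![(1 : ℝ), zetaValue 3, zetaValue 5] with hθ
  have hℓ' : Tendsto (fun n : ℕ => |∑ j, (p n j : ℝ) * θ j| ^ (1 / (n : ℝ))) atTop
      (𝓝 (Real.exp (-σ))) := by
    refine hℓ.congr fun n => ?_
    simp [hθ, Fin.sum_univ_three]
  have hm : ((Fintype.card (Fin 3) : ℝ) - 2) * Q < σ := by
    simp only [Fintype.card_fin, Nat.cast_ofNat]
    linarith
  obtain ⟨hli, hirr⟩ := irrational_of_nesterenko_margin θ 0 (by simp [hθ]) p hσ hQ hp hℓ' hm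
  refine ⟨hli, ?_⟩
  have h := hirr 2 (by decide)
  show Irrational (zetaValue 5)
  simpa [hθ] using h

end Summit.KontsevichZagierPeriods.Zeta5Search
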